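import Summits.ResolutionOfSingularities.ResolutionOfSingularities.Theorems.ValuativeLuAlphaPTorsorLowDim
import Summits.ResolutionOfSingularities.ResolutionOfSingularities.Theorems.ValuativeLuAlphaPTorsorValueExit
import Summits.ResolutionOfSingularities.ResolutionOfSingularities.Theorems.ValuativeLuAlphaPTorsorResidueExit
import Summits.ResolutionOfSingularities.ResolutionOfSingularities.Theorems.ValuativeLuAlphaPTorsorDimTwoMonomialization
import Literature.AlgebraicGeometry.Resolution.RegularLocalRingsNormal

/-!
# `LuAlphaPTorsor` in base dimension two, outside the immediate (defect) case

Crux `Valuative.LuAlphaPTorsor` (item `stmt-ResolutionOfSingularities-0641`), line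
`pfaff-line-log-final-forms` (gen-2 skeleton, lead seat `…-0641-1`). The dimension-two branch of
the line's composition, run with the LANDED stubs `stub_dimTwoMonomialization` (B2),
`stub_valueExit` (C), `stub_residueExit` (D), `stub_birationalExit` and the monomialization of
one element along the quadratic sequence of a two-dimensional regular local ring (stub B1,
`stub_curveMonomialization`) taken as a HYPOTHESIS `hB1` (it is being landed separately; the
unconditional corollary follows by `modus ponens` once it is in the tree):

* `luAlphaPTorsor_dimTwo_of_not_immediate_of_curveMono` — for `k` of characteristic `p`, `O` a
  valuation ring of `K ⊇ k`, `A₀ ⊆ O` finitely generated and regular OF DIMENSION TWO at the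
  centre, `t^p ∈ A₀` with `Frac (A₀[t]) = K`: if `t` is NOT a limit over `K₀ = Frac A₀` (some
  `c ∈ K₀` realises the best approximation `ν(t − c)`; equivalently the degree-`p` extension
  `K/K₀` is defectless at `ν`, cf. `…BestApproximation.lean`), then some finitely generated
  `A ⊇ A₀[t]` inside `O` with `Frac A = K` is regular at the centre.

The glue is elementary valuation algebra over `K₀ ⊆ K` (the value / residue dichotomy for a
best approximation, `t ∉ K₀` from normality of the regular base).
-/

set_option linter.dupNamespace false

namespace Summit.ResolutionOfSingularities.ResolutionOfSingularities.Theorems.PfaffLine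

open IsLocalRing Literature.AlgebraicGeometry.Resolution

section Glue

variable {k K : Type} [Field k] [Field K] [Algebra k K]

/-- Elements of `Frac A₀ ⊆ K` are quotients of elements of `A₀`. [folklore] -/
theorem dimTwo_exists_div_eq_of_mem_closure (A₀ : Subalgebra k K) {z : K}
    (hz : z ∈ Subfield.closure (A₀ : Set K)) : ∃ f ∈ A₀, ∃ g ∈ A₀, z = f / g := by
  obtain ⟨f, hf, g, hg, rfl⟩ := Subfield.mem_closure_iff.mp hz
  have hcl : Subring.closure (A₀ : Set K) = A₀.toSubring := Subring.closure_eq A₀.toSubring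
  rw [hcl] at hf hg
  exact ⟨f, hf, g, hg, rfl⟩

/-- **`t ∉ Frac A₀` when `t^p` is not a `p`-th power in a normal local ring `R` of the base
through which `A₀` embeds injectively.** [folklore] -/
theorem dimTwo_not_mem_closure_of_forall_ne_pow {p : ℕ} (hp : p.Prime)
    (A₀ : Subalgebra k K) (t : K) (htp : t ^ p ∈ A₀)
    {R : Type} [CommRing R] [IsRegularLocalRing R] [Algebra A₀.toSubring R]
    (hinjA : Function.Injective (algebraMap A₀.toSubring R))
    (hpow : ∀ c : R, algebraMap A₀.toSubring R ⟨t ^ p, htp⟩ ≠ c ^ p) :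
    t ∉ Subfield.closure (A₀ : Set K) := by
  classical
  intro ht
  obtain ⟨f, hf, g, hg, hfg⟩ := dimTwo_exists_div_eq_of_mem_closure A₀ ht
  haveI := isDomain_of_isRegularLocalRing R
  haveI := isIntegrallyClosed_of_isRegularLocalRing R
  by_cases hg0 : g = 0
  · have ht0 : t = 0 := by rw [hfg, hg0, div_zero]
    apply hpow 0
    have : (⟨t ^ p, htp⟩ : A₀.toSubring) = 0 := by
      apply Subtype.ext
      simp [ht0, hp.ne_zero]
    rw [this, map_zero, zero_pow hp.ne_zero]
  let L := FractionRing R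
  have hgR : algebraMap A₀.toSubring R ⟨g, hg⟩ ≠ 0 := by
    intro h0
    apply hg0
    have : (⟨g, hg⟩ : A₀.toSubring) = 0 := hinjA (by rw [h0, map_zero])
    exact congrArg Subtype.val this
  have hgL : algebraMap R L (algebraMap A₀.toSubring R ⟨g, hg⟩) ≠ 0 := fun h0 =>
    hgR (IsFractionRing.injective R L (by rw [h0, map_zero]))
  have hgLp : algebraMap R L (algebraMap A₀.toSubring R (⟨g, hg⟩ ^ p)) ≠ 0 := by
    rw [map_pow, map_pow]
    exact pow_ne_zero _ hgL
  set τ : L := algebraMap R L (algebraMap A₀.toSubring R ⟨f, hf⟩) /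
    algebraMap R L (algebraMap A₀.toSubring R ⟨g, hg⟩) with hτ
  have hK : f ^ p = t ^ p * g ^ p := by
    rw [hfg, div_pow, div_mul_cancel₀ _ (pow_ne_zero _ hg0)]
  have hA : (⟨f, hf⟩ : A₀.toSubring) ^ p = ⟨t ^ p, htp⟩ * ⟨g, hg⟩ ^ p := by
    apply Subtype.ext
    simp [hK]
  have h1 : algebraMap R L (algebraMap A₀.toSubring R ⟨f, hf⟩) ^ p =
      algebraMap R L (algebraMap A₀.toSubring R (⟨f, hf⟩ ^ p)) := by
    rw [map_pow, map_pow]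
  have h2 : algebraMap R L (algebraMap A₀.toSubring R ⟨g, hg⟩) ^ p =
      algebraMap R L (algebraMap A₀.toSubring R (⟨g, hg⟩ ^ p)) := by
    rw [map_pow, map_pow]
  have hτp : τ ^ p = algebraMap R L (algebraMap A₀.toSubring R ⟨t ^ p, htp⟩) := by
    rw [hτ, div_pow, h1, h2, hA, map_mul, map_mul, mul_div_assoc, div_self hgLp, mul_one]
  exact not_exists_pow_eq_algebraMap_of_forall_ne_pow hp.ne_zero
    (fun c hc => hpow c hc) τ hτp

/-- If `ν(t − c)` is not the value of any element of `Frac A₀` and `t ∈ O`, then `c ∈ O`.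
[folklore] -/
theorem dimTwo_c_mem_of_value (O : ValuationSubring K) (A₀ : Subalgebra k K) {t c : K} (ht : t ∈ O)
    (hc : c ∈ Subfield.closure (A₀ : Set K))
    (hval : ∀ z : K, z ∈ Subfield.closure (A₀ : Set K) → O.valuation (t - c) ≠ O.valuation z) :
    c ∈ O := by
  by_contra hcO
  have hct : O.valuation t < O.valuation c := by
    have h1 : O.valuation t ≤ 1 := (O.valuation_le_one_iff t).mpr ht
    have h2 : ¬ O.valuation c ≤ 1 := fun h => hcO ((O.valuation_le_one_iff c).mp h)
    exact lt_of_le_of_lt h1 (not_le.mp h2)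
  apply hval (-c) (neg_mem hc)
  rw [sub_eq_add_neg, Valuation.map_add_eq_of_lt_right _ (by rwa [Valuation.map_neg])]

/-- The residue case of a best approximation: if `c` is a best approximation of `t` from
`Frac A₀` and `ν(t − c) = ν(g)` with `0 ≠ g ∈ Frac A₀`, then no `z ∈ Frac A₀` has
`ν((t − c)/g − z) < 1`. [folklore] -/
theorem dimTwo_residue_hyp_of_best (O : ValuationSubring K) (A₀ : Subalgebra k K) {t c g : K}
    (hc : c ∈ Subfield.closure (A₀ : Set K)) (hg : g ∈ Subfield.closure (A₀ : Set K)) (hg0 : g ≠ 0)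
    (hval : O.valuation (t - c) = O.valuation g)
    (hmin : ∀ c' : K, c' ∈ Subfield.closure (A₀ : Set K) →
      O.valuation (t - c) ≤ O.valuation (t - c')) :
    ∀ z : K, z ∈ Subfield.closure (A₀ : Set K) → ¬ O.valuation ((t - c) / g - z) < 1 := by
  intro z hz hlt
  have hc' : c + g * z ∈ Subfield.closure (A₀ : Set K) := add_mem hc (mul_mem hg hz)
  have h := hmin (c + g * z) hc'
  have hrew : t - (c + g * z) = g * ((t - c) / g - z) := by
    field_simp
    ring
  rw [hrew, Valuation.map_mul, hval] at h
  have hg1 : O.valuation g ≠ 0 := (Valuation.ne_zero_iff _).mpr hg0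
  have : O.valuation g * O.valuation ((t - c) / g - z) < O.valuation g * 1 :=
    mul_lt_mul_of_pos_left hlt (zero_lt_iff.mpr hg1)
  rw [mul_one] at this
  exact absurd h (not_le.mpr this)

/-- In the residue case `c, g ∈ O` and `b = (t^p − c^p)/g^p` is a unit of `O` with
`t^p − c^p = g^p · b`. [folklore] -/
theorem dimTwo_mem_of_residue_hyp {p : ℕ} (hp : p.Prime) [CharP K p] (O : ValuationSubring K)
    (A₀ : Subalgebra k K) {t c g : K} (ht : t ∈ O)
    (hc : c ∈ Subfield.closure (A₀ : Set K)) (hg : g ∈ Subfield.closure (A₀ : Set K)) (hg0 : g ≠ 0)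
    (hval : O.valuation (t - c) = O.valuation g)
    (hres : ∀ z : K, z ∈ Subfield.closure (A₀ : Set K) → ¬ O.valuation ((t - c) / g - z) < 1) :
    c ∈ O ∧ g ∈ O ∧ (t ^ p - c ^ p) / g ^ p ∈ O ∧ ((t ^ p - c ^ p) / g ^ p)⁻¹ ∈ O ∧
      t ^ p - c ^ p = g ^ p * ((t ^ p - c ^ p) / g ^ p) := by
  have hg1 : O.valuation g ≠ 0 := (Valuation.ne_zero_iff _).mpr hg0
  have hcO : c ∈ O := by
    by_contra hcO
    have h1 : O.valuation t ≤ 1 := (O.valuation_le_one_iff t).mpr ht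
    have h2 : 1 < O.valuation c := not_le.mp fun h => hcO ((O.valuation_le_one_iff c).mp h)
    have hct : O.valuation t < O.valuation c := lt_of_le_of_lt h1 h2
    have htc : O.valuation (t - c) = O.valuation c := by
      rw [sub_eq_add_neg, Valuation.map_add_eq_of_lt_right _ (by rwa [Valuation.map_neg]),
        Valuation.map_neg]
    apply hres (-c / g) (div_mem (neg_mem hc) hg)
    have : (t - c) / g - -c / g = t / g := by field_simp; ring
    rw [this, Valuation.map_div, ← hval, htc]
    exact (div_lt_one₀ (lt_trans (zero_lt_one) h2 |> fun h => h)).mpr hct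
  have hgO : g ∈ O := by
    rw [← O.valuation_le_one_iff, ← hval]
    exact (O.valuation_le_one_iff _).mpr (sub_mem ht hcO)
  haveI : ExpChar K p := ExpChar.prime hp
  have hb : (t ^ p - c ^ p) / g ^ p = ((t - c) / g) ^ p := by
    rw [div_pow, sub_pow_expChar]
  have hθ : O.valuation ((t - c) / g) = 1 := by
    rw [Valuation.map_div, hval, div_self hg1]
  refine ⟨hcO, hgO, ?_, ?_, ?_⟩
  · rw [← O.valuation_le_one_iff, hb, Valuation.map_pow, hθ, one_pow]
  · rw [← O.valuation_le_one_iff, hb, ← inv_pow, Valuation.map_pow, Valuation.map_inv, hθ,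
      inv_one, one_pow]
  · rw [mul_div_cancel₀ _ (pow_ne_zero _ hg0)]

end Glue

/-- **`LuAlphaPTorsor` in base dimension two for torsor extensions that are NOT immediate at
`ν`**, modulo the monomialization statement of stub B1 (`stub_curveMonomialization`, first
hypothesis, being landed separately). In the setting of the crux (`k` of characteristic `p`,
`A₀ ⊆ O` finitely generated and regular at the centre, `t^p ∈ A₀`, `Frac (A₀[t]) = K`) with the
base of dimension TWO at the centre: if some `c ∈ K₀ = Frac A₀` is a best approximation of `t`
(`ν(t − c) ≤ ν(t − c')` for all `c' ∈ K₀`; by `…BestApproximation.lean` this holds whenever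
`K/K₀` is defectless at `ν`), then some finitely generated `A ⊇ A₀[t]` inside `O` with
`Frac A = K` is regular at the centre. Proof: the dimension-two branch of the line — birational
exit if `t^p` is a `p`-th power at the centre; otherwise `t ∉ K₀` (normality), and either
`ν(t − c) ∉ νK₀` (value exit `stub_valueExit`, after monomializing `t^p − c^p` on a blown-up
model by `stub_dimTwoMonomialization`) or `ν(t − c) = ν(g)` and the residue of `(t − c)/g` is
new (residue exit `stub_residueExit`, after absorbing `c, g, b, b⁻¹`). [folklore assembly] -/
theorem luAlphaPTorsor_dimTwo_of_not_immediate_of_curveMono :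
    (∀ (K' : Type) [Field K'] (O' : ValuationSubring K') (R : ℕ → Subring K'), IsRegularLocalRing (R 0) → ringKrullDim (R 0) = 2 → Literature.AlgebraicGeometry.Resolution.IsLocalRingOf (R 0) → Literature.AlgebraicGeometry.Resolution.SubringDominates (R 0) O'.toSubring → (∀ i, Literature.AlgebraicGeometry.Resolution.IsQuadraticTransformAlong O' (R i) (R (i + 1))) → (∀ (𝔮 : Ideal (R 0)) (L : Type) [Field L] [Algebra (R 0 ⧸ 𝔮) L] [IsFractionRing (R 0 ⧸ 𝔮) L], 𝔮.IsPrime → ringKrullDim (R 0 ⧸ 𝔮) = 1 → Module.Finite (R 0 ⧸ 𝔮) (integralClosure (R 0 ⧸ 𝔮) L)) → ∀ (i₀ : ℕ) (b : K'), b ∈ R i₀ → b ≠ 0 → ∃ i : ℕ, i₀ ≤ i ∧ ∃ (d : ℕ) (u : Fin d → R i) (M : Fin d → ℕ) (w : R i), IsUnit w ∧ (∀ z : R i, z ∈ Ideal.span (Set.range u) ↔ ¬ IsUnit z) ∧ ringKrullDim (R i) = (d : WithBot ℕ∞) ∧ b = (Finset.univ.prod fun j => ((u j : R i) : K') ^ M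 j) * ((w : R i) : K')) → ∀ p : ℕ, p.Prime → ∀ (k K : Type) [Field k] [CharP k p] [Field K] [Algebra k K] (O : ValuationSubring K) (A₀ : Subalgebra k K) (h₀ : A₀.toSubring ≤ O.toSubring) (t : K), A₀.FG → t ^ p ∈ A₀ → IsFractionRing (Algebra.adjoin k (insert t (A₀ : Set K))) K → IsRegularLocalRing (Localization.AtPrime (Ideal.comap (Subring.inclusion h₀) (IsLocalRing.maximalIdeal O))) → ringKrullDim (Localization.AtPrime (Ideal.comap (Subring.inclusion h₀) (IsLocalRing.maximalIdeal O))) = 2 → (∃ c : K, c ∈ Subfield.closure (A₀ : Set K) ∧ ∀ c' : K, c' ∈ Subfield.closure (A₀ : Set K) → O.valuation (t - c) ≤ O.valuation (t - c')) → ∃ (A : Subalgebra k K) (h : A.toSubring ≤ O.toSubring), A₀ ≤ A ∧ t ∈ A ∧ A.FG ∧ IsFractionRing A K ∧ IsRegularLocalRing (Localization.AtPrime (Ideal.comap (Subring.inclusion h) (IsLocalRing.maximalIdeal O))) := by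
  classical
  intro hB1 p hp k K _ _ _ _ O A₀ h₀ t hfg htp hfr hreg hdim2 hbest
  -- the birational case
  by_cases hpow : ∃ c : Localization.AtPrime (Ideal.comap (Subring.inclusion h₀)
      (IsLocalRing.maximalIdeal O)), algebraMap A₀.toSubring (Localization.AtPrime
        (Ideal.comap (Subring.inclusion h₀) (IsLocalRing.maximalIdeal O))) ⟨t ^ p, htp⟩ = c ^ p
  · exact stub_birationalExit p hp k K O A₀ h₀ t hfg htp hfr hreg hpow
  push Not at hpow
  haveI : CharP K p := charP_of_injective_algebraMap (algebraMap k K).injective p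
  have htO : t ∈ O := mem_valuationSubring_of_pow_mem O hp.ne_zero (h₀ htp)
  have htK₀ : t ∉ Subfield.closure (A₀ : Set K) :=
    dimTwo_not_mem_closure_of_forall_ne_pow hp A₀ t htp
      (IsLocalization.injective (Localization.AtPrime (Ideal.comap (Subring.inclusion h₀)
        (IsLocalRing.maximalIdeal O))) (M := (Ideal.comap (Subring.inclusion h₀)
        (IsLocalRing.maximalIdeal O)).primeCompl) (Ideal.primeCompl_le_nonZeroDivisors _)) hpow
  obtain ⟨c, hc, hmin⟩ := hbest
  have htc0 : t - c ≠ 0 := fun h => htK₀ (by rw [sub_eq_zero.mp h]; exact hc)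
  by_cases hval : ∃ g : K, g ∈ Subfield.closure (A₀ : Set K) ∧ g ≠ 0 ∧
      O.valuation (t - c) = O.valuation g
  · -- residue case
    obtain ⟨g, hg, hg0, hvg⟩ := hval
    have hres := dimTwo_residue_hyp_of_best O A₀ hc hg hg0 hvg hmin
    obtain ⟨hcO, hgO, hbO, hbiO, hbeq⟩ := dimTwo_mem_of_residue_hyp hp O A₀ htO hc hg hg0 hvg hres
    set b : K := (t ^ p - c ^ p) / g ^ p with hb
    have hb0 : b ≠ 0 := by
      rw [hb]
      refine div_ne_zero ?_ (pow_ne_zero _ hg0)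
      haveI : ExpChar K p := ExpChar.prime hp
      rw [← sub_pow_expChar]
      exact pow_ne_zero _ htc0
    have htpK₀ : t ^ p ∈ Subfield.closure (A₀ : Set K) := Subfield.subset_closure htp
    have hbK₀ : b ∈ Subfield.closure (A₀ : Set K) :=
      div_mem (sub_mem htpK₀ (pow_mem hc p)) (pow_mem hg p)
    have hF : ∀ z ∈ ({c, g, b, b⁻¹} : Finset K), z ∈ O ∧ z ∈ Subfield.closure (A₀ : Set K) := by
      intro z hz
      simp only [Finset.mem_insert, Finset.mem_singleton] at hz
      rcases hz with rfl | rfl | rfl | rfl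
      · exact ⟨hcO, hc⟩
      · exact ⟨hgO, hg⟩
      · exact ⟨hbO, hbK₀⟩
      · exact ⟨hbiO, inv_mem hbK₀⟩
    obtain ⟨A₁, h₁, hle, hA₁fg, hFA₁, hA₁K₀, hA₁reg, -⟩ :=
      stub_dimTwoMonomialization hB1 k K O A₀ h₀ hfg hreg hdim2 {c, g, b, b⁻¹} hF b
        (by simp) hb0
    have hfr₁ : IsFractionRing (Algebra.adjoin k (insert t (A₁ : Set K))) K :=
      isFractionRing_of_le (adjoin_insert_mono' hle t) hfr
    have hcA : c ∈ A₁ := hFA₁ (by simp)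
    have hgA : g ∈ A₁ := hFA₁ (by simp)
    have hbA : b ∈ A₁ := hFA₁ (by simp)
    have hbiA : b⁻¹ ∈ A₁ := hFA₁ (by simp)
    have hres₁ : ∀ z : K, z ∈ Subfield.closure (A₁ : Set K) → ¬ O.valuation ((t - c) / g - z) < 1 :=
      fun z hz => hres z (Subfield.closure_le.mpr hA₁K₀ hz)
    obtain ⟨A, h, hle₁, ht, hAfg, hAfr, hAreg⟩ := stub_residueExit p hp k K O A₁ h₁ t hA₁fg
      (hle htp) hfr₁ hA₁reg c g b hcA hgA hbA hbiA hg0 hbeq hres₁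
    exact ⟨A, h, hle.trans hle₁, ht, hAfg, hAfr, hAreg⟩
  · -- value case
    push Not at hval
    have hvalue : ∀ z : K, z ∈ Subfield.closure (A₀ : Set K) → O.valuation (t - c) ≠ O.valuation z := by
      intro z hz
      by_cases hz0 : z = 0
      · rw [hz0, Valuation.map_zero]
        exact (Valuation.ne_zero_iff _).mpr htc0
      · exact hval z hz hz0
    have hcO : c ∈ O := dimTwo_c_mem_of_value O A₀ htO hc hvalue
    set b : K := t ^ p - c ^ p with hb
    have hb0 : b ≠ 0 := by
      haveI : ExpChar K p := ExpChar.prime hp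
      rw [hb, ← sub_pow_expChar]
      exact pow_ne_zero _ htc0
    have htpK₀ : t ^ p ∈ Subfield.closure (A₀ : Set K) := Subfield.subset_closure htp
    have hbK₀ : b ∈ Subfield.closure (A₀ : Set K) := sub_mem htpK₀ (pow_mem hc p)
    have hbO : b ∈ O := sub_mem (h₀ htp) (pow_mem hcO p)
    have hF : ∀ z ∈ ({c, b} : Finset K), z ∈ O ∧ z ∈ Subfield.closure (A₀ : Set K) := by
      intro z hz
      simp only [Finset.mem_insert, Finset.mem_singleton] at hz
      rcases hz with rfl | rfl
      · exact ⟨hcO, hc⟩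
      · exact ⟨hbO, hbK₀⟩
    obtain ⟨A₁, h₁, hle, hA₁fg, hFA₁, hA₁K₀, hA₁reg, d, x, hx, M, w, hw, hwi, hspan, hdimd, hbeq⟩ :=
      stub_dimTwoMonomialization hB1 k K O A₀ h₀ hfg hreg hdim2 {c, b} hF b (by simp) hb0
    have hfr₁ : IsFractionRing (Algebra.adjoin k (insert t (A₁ : Set K))) K :=
      isFractionRing_of_le (adjoin_insert_mono' hle t) hfr
    have hcA : c ∈ A₁ := hFA₁ (by simp)
    have hvalue₁ : ∀ z : K, z ∈ Subfield.closure (A₁ : Set K) → O.valuation (t - c) ≠ O.valuation z :=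
      fun z hz => hvalue z (Subfield.closure_le.mpr hA₁K₀ hz)
    obtain ⟨A, h, hle₁, ht, hAfg, hAfr, hAreg⟩ := stub_valueExit p hp k K O A₁ h₁ t hA₁fg
      (hle htp) hfr₁ hA₁reg c hcA hvalue₁ ⟨d, x, hx, M, w, hw, hwi, hspan, hdimd, hbeq⟩
    exact ⟨A, h, hle.trans hle₁, ht, hAfg, hAfr, hAreg⟩

end Summit.ResolutionOfSingularities.ResolutionOfSingularities.Theorems.PfaffLine
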